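import Mathlib
import Literature.NumberTheory.LFunctions.Zhang2022.SkeletonPartThree
import HarnessLib

/-!
# Zhang (2022) §15 p. 88: the ratios `β₁β₂/((β_{j+1}−βⱼ)(β_{j+2}−βⱼ))` and the pointwise product
# bound behind `ℛ₁*ℛ₁ⱼ = 1, 2, 1`

Topic `Literature/NumberTheory/LFunctions/Zhang2022` (Landau–Siegel audit tree; verdict-neutral).
Y. Zhang, *Discrete mean estimates and the Landau–Siegel zero*, arXiv:2211.02515v1 (2022)
[Zhang2022LandauSiegel] — an unrefereed manuscript under adjudication (cell siegel-zhang, D-0069,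
discharge lane, node `Skeleton.Ded1524`). For the "direct calculation" of §15 p. 88 (tex
L4385–L4392: `ℛ₁*ℛ₁₁ = 1 + O(1/𝓛)`, `ℛ₁*ℛ₁₂ = 2 + O(1/𝓛)`, `ℛ₁*ℛ₁₃ = 1 + O(1/𝓛)`) this file
proves, with `θ = c′α𝓛` and the shifts of (2.13) (`βⱼ = i bⱼ`, the skeleton's `b1, b2, b3`):

* `beta_ratios` — `β₁β₂/((β₂−β₁)(β₃−β₁)) = (1−5θ)/(1+7θ)`, `β₁β₂/((β₃−β₂)(β₁−β₂)) =
  −2(1+θ)/(1+7θ)`, `β₁β₂/((β₁−β₃)(β₂−β₃)) = 1` (exact);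
* `beta_sizes` — for `|θ| ≤ 1/14`: `|β₁β₂| ≤ 4α²` and the three denominators are `≥ α²/4`;
* `ratio_devs` — `|(1−5θ)/(1+7θ) − 1|, |−2(1+θ)/(1+7θ) + 2| ≤ 24|θ|`;
* `prod_bound` — the pointwise bookkeeping: from `‖ℛ* − νL‖ ≤ E₁`, `‖ℛ − w/(dL)‖ ≤ E₂`,
  `m₀ ≤ |L| ≤ L₁`, `|d| ≥ a²/4`, `|ν| ≤ 4a²`, `ν/d = r`, `|r − r₀| ≤ δ_r`, `|w| = 1`, `|w − s| ≤ δ_w`: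
  `‖ℛ*ℛ − r₀s‖ ≤ E₁(4/(a²m₀) + E₂) + 4a²L₁E₂ + (δ_r + |r₀|δ_w)`;
* `collect` — with `α = π𝓛⁻⁹`, `E₁ = |C₁|𝓛⁻²⁴`, `E₂ = |C₂|𝓛⁻³`, `L₁ = 4e^{9/2}𝓛²`, `|θ| = |c′|π𝓛⁻⁸`
  every term is `≤ const·𝓛⁻⁵`.

Companions: `Section15P4Phase` (the phases `P₄^{β₃−βⱼ}`), `Section15RhoProductsRate` (assembly),
`Section15Eval1524` (the step to (15.24), which consumes the rate `O(𝓛⁻⁵)`).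
WHAT THIS IS NOT: any claim about Theorems 1–2 of the manuscript or Landau–Siegel zeros.

## References
* Y. Zhang, arXiv:2211.02515v1 (2022), §15 p. 88; §2 (2.10), (2.13). [cite: Zhang2022LandauSiegel, §15 p.88]
-/

noncomputable section

open Complex Real ComplexConjugate
open Literature.NumberTheory.LFunctions.Zhang2022.Skeleton

namespace Literature.NumberTheory.LFunctions.Zhang2022.Ded1524

/-! ## 2. The shifts of (2.13): `βⱼ = i bⱼ`, the ratios `β₁β₂/((β_{j+1}−βⱼ)(β_{j+2}−βⱼ))` -/

section Betas

variable (c' : ℝ) (D : ℕ)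

/-- `β₁ = i b₁`, `β₂ = i b₂`, `β₃ = i b₃` (the skeleton's real shift sizes `b1, b2, b3`).
[cite: Zhang2022LandauSiegel, §2 (2.13)] -/
theorem beta_eq_b_mul_I :
    beta1 c' D = (b1 c' D : ℂ) * I ∧ beta2 c' D = (b2 c' D : ℂ) * I ∧ beta3 c' D = (b3 c' D : ℂ) * I := by
  refine ⟨?_, ?_, ?_⟩
  · rw [beta1, b1]; push_cast; ring
  · rw [beta2, b2]; push_cast; ring
  · rw [beta3, b3]; push_cast; ring

/-- `(xI)(yI)/((uI)(vI)) = xy/(uv)` for reals (both sides `0` if `uv = 0`). [folklore] -/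
private theorem mulI_div_mulI (x y u v : ℝ) :
    ((x : ℂ) * I) * ((y : ℂ) * I) / (((u : ℂ) * I) * ((v : ℂ) * I)) = ((x * y / (u * v) : ℝ) : ℂ) := by
  have h1 : ((x : ℂ) * I) * ((y : ℂ) * I) = -((x * y : ℝ) : ℂ) := by
    push_cast; linear_combination ((x : ℂ) * y) * Complex.I_sq
  have h2 : ((u : ℂ) * I) * ((v : ℂ) * I) = -((u * v : ℝ) : ℂ) := by
    push_cast; linear_combination ((u : ℂ) * v) * Complex.I_sq
  rw [h1, h2, neg_div_neg_eq]; push_cast; rfl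

/-- **The three ratios** (§15 p.88, "by direct calculation"), with `θ = c′α𝓛`:
`β₁β₂/((β₂−β₁)(β₃−β₁)) = (1−5θ)/(1+7θ)`, `β₁β₂/((β₃−β₂)(β₁−β₂)) = −2(1+θ)/(1+7θ)`,
`β₁β₂/((β₁−β₃)(β₂−β₃)) = 1` (`α ≠ 0`, `1+θ ≠ 0`, `1−5θ ≠ 0`, `1+7θ ≠ 0`).
[cite: Zhang2022LandauSiegel, §15 p.88] -/
theorem beta_ratios (hα : alpha D ≠ 0) (h1 : 1 + c' * alpha D * ell D ≠ 0)
    (h5 : 1 - 5 * (c' * alpha D * ell D) ≠ 0) (h7 : 1 + 7 * (c' * alpha D * ell D) ≠ 0) :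
    beta1 c' D * beta2 c' D / ((beta2 c' D - beta1 c' D) * (beta3 c' D - beta1 c' D)) =
        (((1 - 5 * (c' * alpha D * ell D)) / (1 + 7 * (c' * alpha D * ell D)) : ℝ) : ℂ) ∧
      beta1 c' D * beta2 c' D / ((beta3 c' D - beta2 c' D) * (beta1 c' D - beta2 c' D)) =
        ((-2 * (1 + c' * alpha D * ell D) / (1 + 7 * (c' * alpha D * ell D)) : ℝ) : ℂ) ∧
      beta1 c' D * beta2 c' D / ((beta1 c' D - beta3 c' D) * (beta2 c' D - beta3 c' D)) = 1 := by
  obtain ⟨e1, e2, e3⟩ := beta_eq_b_mul_I c' D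
  set θ : ℝ := c' * alpha D * ell D with hθ
  have hb1 : b1 c' D = alpha D * (1 - 5 * θ) := by rw [b1, hθ]; ring
  have hb2 : b2 c' D = 2 * alpha D * (1 + θ) := by rw [b2, hθ]
  have hb3 : b3 c' D = 3 * alpha D * (1 - θ) := by rw [b3, hθ]
  have hsub : ∀ p q : ℝ, (p : ℂ) * I - (q : ℂ) * I = ((p - q : ℝ) : ℂ) * I := by
    intro p q; push_cast; ring
  rw [e1, e2, e3, hsub, hsub, hsub, hsub, hsub, hsub, mulI_div_mulI, mulI_div_mulI, mulI_div_mulI,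
    hb1, hb2, hb3]
  refine ⟨?_, ?_, ?_⟩
  · congr 1
    rw [div_eq_div_iff (by
      have : (2 * alpha D * (1 + θ) - alpha D * (1 - 5 * θ)) * (3 * alpha D * (1 - θ) - alpha D * (1 - 5 * θ))
        = 2 * alpha D ^ 2 * ((1 + 7 * θ) * (1 + θ)) := by ring
      rw [this]; exact mul_ne_zero (by positivity) (mul_ne_zero h7 h1)) h7]
    ring
  · congr 1
    rw [div_eq_div_iff (by
      have : (3 * alpha D * (1 - θ) - 2 * alpha D * (1 + θ)) * (alpha D * (1 - 5 * θ) - 2 * alpha D * (1 + θ))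
        = -(alpha D ^ 2 * ((1 - 5 * θ) * (1 + 7 * θ))) := by ring
      rw [this]; exact neg_ne_zero.mpr (mul_ne_zero (by positivity) (mul_ne_zero h5 h7))) h7]
    ring
  · have hden : (alpha D * (1 - 5 * θ) - 3 * alpha D * (1 - θ)) * (2 * alpha D * (1 + θ) - 3 * alpha D * (1 - θ))
        = alpha D * (1 - 5 * θ) * (2 * alpha D * (1 + θ)) := by ring
    rw [hden, div_self (mul_ne_zero (mul_ne_zero hα h5) (mul_ne_zero (mul_ne_zero two_ne_zero hα) h1))]
    push_cast; rfl

/-- Sizes: for `|θ| ≤ 1/14` (`θ = c′α𝓛`) and `α ≥ 0`: `‖β₁β₂‖ ≤ 4α²` and the three denominators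
`‖(β_{j+1}−βⱼ)(β_{j+2}−βⱼ)‖ ≥ α²/4`. [cite: Zhang2022LandauSiegel, §2 (2.13)] -/
theorem beta_sizes (hα : 0 ≤ alpha D) (hθ : |c' * alpha D * ell D| ≤ 1 / 14) :
    ‖beta1 c' D * beta2 c' D‖ ≤ 4 * alpha D ^ 2 ∧
      alpha D ^ 2 / 4 ≤ ‖(beta2 c' D - beta1 c' D) * (beta3 c' D - beta1 c' D)‖ ∧
      alpha D ^ 2 / 4 ≤ ‖(beta3 c' D - beta2 c' D) * (beta1 c' D - beta2 c' D)‖ ∧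
      alpha D ^ 2 / 4 ≤ ‖(beta1 c' D - beta3 c' D) * (beta2 c' D - beta3 c' D)‖ := by
  obtain ⟨e1, e2, e3⟩ := beta_eq_b_mul_I c' D
  set θ : ℝ := c' * alpha D * ell D with hθdef
  have hb1 : b1 c' D = alpha D * (1 - 5 * θ) := by rw [b1, hθdef]; ring
  have hb2 : b2 c' D = 2 * alpha D * (1 + θ) := by rw [b2, hθdef]
  have hb3 : b3 c' D = 3 * alpha D * (1 - θ) := by rw [b3, hθdef]
  have hθ' := abs_le.mp hθ
  have nI : ∀ p : ℝ, ‖(p : ℂ) * I‖ = |p| := fun p => by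
    rw [norm_mul, Complex.norm_I, mul_one, Complex.norm_real, Real.norm_eq_abs]
  have hsub : ∀ p q : ℝ, (p : ℂ) * I - (q : ℂ) * I = ((p - q : ℝ) : ℂ) * I := by
    intro p q; push_cast; ring
  rw [e1, e2, e3, hsub, hsub, hsub, hsub, hsub, hsub]
  simp only [norm_mul, nI, hb1, hb2, hb3]
  have hα2 : 0 ≤ alpha D ^ 2 := sq_nonneg _
  have k1 : 0 ≤ 1 - 5 * θ := by linarith
  have k2 : 0 ≤ 1 + θ := by linarith
  have k3 : 0 ≤ 1 + 7 * θ := by linarith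
  have k4 : 0 ≤ 2 + 2 * θ := by linarith
  have q1 : (1 - 5 * θ) * (2 * (1 + θ)) ≤ 4 := by nlinarith
  have q2 : 1 / 4 ≤ (1 + 7 * θ) * (2 + 2 * θ) := by nlinarith
  have q3 : 1 / 4 ≤ (1 - 5 * θ) * (1 + 7 * θ) := by nlinarith
  have q4 : 1 / 4 ≤ (2 + 2 * θ) * (1 - 5 * θ) := by nlinarith
  refine ⟨?_, ?_, ?_, ?_⟩
  · rw [abs_of_nonneg (by nlinarith), abs_of_nonneg (by nlinarith)]
    calc alpha D * (1 - 5 * θ) * (2 * alpha D * (1 + θ)) = alpha D ^ 2 * ((1 - 5 * θ) * (2 * (1 + θ))) := by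
          ring
      _ ≤ alpha D ^ 2 * 4 := mul_le_mul_of_nonneg_left q1 hα2
      _ = 4 * alpha D ^ 2 := by ring
  · rw [show 2 * alpha D * (1 + θ) - alpha D * (1 - 5 * θ) = alpha D * (1 + 7 * θ) by ring,
      show 3 * alpha D * (1 - θ) - alpha D * (1 - 5 * θ) = alpha D * (2 + 2 * θ) by ring,
      abs_of_nonneg (by nlinarith), abs_of_nonneg (by nlinarith)]
    calc alpha D ^ 2 / 4 = alpha D ^ 2 * (1 / 4) := by ring
      _ ≤ alpha D ^ 2 * ((1 + 7 * θ) * (2 + 2 * θ)) := mul_le_mul_of_nonneg_left q2 hα2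
      _ = alpha D * (1 + 7 * θ) * (alpha D * (2 + 2 * θ)) := by ring
  · rw [show 3 * alpha D * (1 - θ) - 2 * alpha D * (1 + θ) = alpha D * (1 - 5 * θ) by ring,
      show alpha D * (1 - 5 * θ) - 2 * alpha D * (1 + θ) = -(alpha D * (1 + 7 * θ)) by ring, abs_neg,
      abs_of_nonneg (by nlinarith), abs_of_nonneg (by nlinarith)]
    calc alpha D ^ 2 / 4 = alpha D ^ 2 * (1 / 4) := by ring
      _ ≤ alpha D ^ 2 * ((1 - 5 * θ) * (1 + 7 * θ)) := mul_le_mul_of_nonneg_left q3 hα2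
      _ = alpha D * (1 - 5 * θ) * (alpha D * (1 + 7 * θ)) := by ring
  · rw [show alpha D * (1 - 5 * θ) - 3 * alpha D * (1 - θ) = -(alpha D * (2 + 2 * θ)) by ring,
      show 2 * alpha D * (1 + θ) - 3 * alpha D * (1 - θ) = -(alpha D * (1 - 5 * θ)) by ring, abs_neg,
      abs_neg, abs_of_nonneg (by nlinarith), abs_of_nonneg (by nlinarith)]
    calc alpha D ^ 2 / 4 = alpha D ^ 2 * (1 / 4) := by ring
      _ ≤ alpha D ^ 2 * ((2 + 2 * θ) * (1 - 5 * θ)) := mul_le_mul_of_nonneg_left q4 hα2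
      _ = alpha D * (2 + 2 * θ) * (alpha D * (1 - 5 * θ)) := by ring

end Betas

/-! ## 3. One product `ℛ₁*ℛ₁ⱼ`, pointwise -/

/-- **Pointwise form of the "direct calculation".** If `‖ℛ* − νL‖ ≤ E₁` and `‖ℛ − w/(dL)‖ ≤ E₂` with
`m₀ ≤ |L| ≤ L₁`, `|d| ≥ a²/4`, `|ν| ≤ 4a²`, `ν/d = r` real with `|r − r₀| ≤ δ_r`, `|w| = 1`,
`|w − s| ≤ δ_w`, then `‖ℛ*ℛ − r₀s‖ ≤ E₁(4/(a²m₀) + E₂) + 4a²L₁E₂ + (δ_r + |r₀|δ_w)` — from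
`ℛ*ℛ − r₀s = (ℛ* − νL)ℛ + νL(ℛ − w/(dL)) + (r·w − r₀s)`. [cite: Zhang2022LandauSiegel, §15 p.88] -/
theorem prod_bound {Rs R L d w ν s : ℂ} {r r₀ E₁ E₂ a m₀ L₁ δr δw : ℝ}
    (ha : 0 < a) (hm₀ : 0 < m₀) (hL₀ : m₀ ≤ ‖L‖) (hL₁ : ‖L‖ ≤ L₁) (hd : a ^ 2 / 4 ≤ ‖d‖)
    (hν : ‖ν‖ ≤ 4 * a ^ 2) (hratio : ν / d = (r : ℂ)) (hr : |r - r₀| ≤ δr)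
    (hw1 : ‖w‖ = 1) (hws : ‖w - s‖ ≤ δw)
    (hRs : ‖Rs - ν * L‖ ≤ E₁) (hR : ‖R - w / (d * L)‖ ≤ E₂) :
    ‖Rs * R - r₀ * s‖ ≤ E₁ * (4 / (a ^ 2 * m₀) + E₂) + 4 * a ^ 2 * L₁ * E₂ + (δr + |r₀| * δw) := by
  have hd0 : d ≠ 0 := by
    intro h; rw [h, norm_zero] at hd; nlinarith [pow_pos ha 2]
  have hL0 : L ≠ 0 := by
    intro h; rw [h, norm_zero] at hL₀; linarith
  have hE₁ : 0 ≤ E₁ := (norm_nonneg _).trans hRs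
  have key : Rs * R - r₀ * s =
      (Rs - ν * L) * R + ν * L * (R - w / (d * L)) + ((r : ℂ) * w - r₀ * s) := by
    rw [← hratio]; field_simp; ring
  have hM : ‖w / (d * L)‖ ≤ 4 / (a ^ 2 * m₀) := by
    rw [norm_div, norm_mul, hw1, div_le_div_iff₀ (by positivity) (by positivity)]
    calc 1 * (a ^ 2 * m₀) = 4 * (a ^ 2 / 4 * m₀) := by ring
      _ ≤ 4 * (‖d‖ * ‖L‖) := by gcongr
  have hRn : ‖R‖ ≤ 4 / (a ^ 2 * m₀) + E₂ := by
    calc ‖R‖ = ‖w / (d * L) + (R - w / (d * L))‖ := by ring_nf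
      _ ≤ ‖w / (d * L)‖ + ‖R - w / (d * L)‖ := norm_add_le _ _
      _ ≤ 4 / (a ^ 2 * m₀) + E₂ := add_le_add hM hR
  have h3 : ‖(r : ℂ) * w - r₀ * s‖ ≤ δr + |r₀| * δw := by
    calc ‖(r : ℂ) * w - r₀ * s‖ = ‖((r - r₀ : ℝ) : ℂ) * w + r₀ * (w - s)‖ := by push_cast; ring_nf
      _ ≤ ‖((r - r₀ : ℝ) : ℂ) * w‖ + ‖(r₀ : ℂ) * (w - s)‖ := norm_add_le _ _
      _ = |r - r₀| * 1 + |r₀| * ‖w - s‖ := by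
          rw [norm_mul, norm_mul, Complex.norm_real, Complex.norm_real, Real.norm_eq_abs,
            Real.norm_eq_abs, hw1]
      _ ≤ δr * 1 + |r₀| * δw := by gcongr
      _ = δr + |r₀| * δw := by ring
  rw [key]
  calc ‖(Rs - ν * L) * R + ν * L * (R - w / (d * L)) + ((r : ℂ) * w - r₀ * s)‖
      ≤ ‖(Rs - ν * L) * R‖ + ‖ν * L * (R - w / (d * L))‖ + ‖(r : ℂ) * w - r₀ * s‖ :=
        (norm_add_le _ _).trans (by gcongr; exact norm_add_le _ _)
    _ ≤ E₁ * (4 / (a ^ 2 * m₀) + E₂) + 4 * a ^ 2 * L₁ * E₂ + (δr + |r₀| * δw) := by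
        have hL₁0 : 0 ≤ L₁ := (norm_nonneg _).trans hL₁
        have : 0 ≤ 4 * a ^ 2 * L₁ := by positivity
        rw [norm_mul, norm_mul, norm_mul]
        gcongr


/-- `1/𝓛ⁿ ≤ 1/𝓛⁵` for `𝓛 ≥ 1`, `n ≥ 5`. [folklore] -/
private theorem inv_pow_le_inv_pow5 {ℓ : ℝ} (hℓ : 1 ≤ ℓ) {n : ℕ} (hn : 5 ≤ n) :
    1 / ℓ ^ n ≤ 1 / ℓ ^ 5 :=
  one_div_le_one_div_of_le (by positivity) (pow_le_pow_right₀ hℓ hn)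

/-- The ratios' deviations: `|(1−5θ)/(1+7θ) − 1| ≤ 24|θ|`, `|−2(1+θ)/(1+7θ) + 2| ≤ 24|θ|` for `|θ| ≤ 1/14`.
[cite: Zhang2022LandauSiegel, §15 p.88] -/
theorem ratio_devs {θ : ℝ} (hθ : |θ| ≤ 1 / 14) :
    |(1 - 5 * θ) / (1 + 7 * θ) - 1| ≤ 24 * |θ| ∧ |-2 * (1 + θ) / (1 + 7 * θ) - (-2)| ≤ 24 * |θ| := by
  have hθ' := abs_le.mp hθ
  have h7' : (0:ℝ) < 1 + 7 * θ := by linarith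
  have h7ne : 1 + 7 * θ ≠ 0 := h7'.ne'
  have key := mul_nonneg (abs_nonneg θ) (show (0:ℝ) ≤ 1 + 14 * θ by linarith)
  constructor
  · rw [show (1 - 5 * θ) / (1 + 7 * θ) - 1 = (-12 * θ) / (1 + 7 * θ) by
      rw [div_sub' h7ne]; congr 1; ring, abs_div, abs_mul, abs_of_pos h7', div_le_iff₀ h7',
      show |(-12 : ℝ)| = 12 by norm_num]
    nlinarith
  · rw [show -2 * (1 + θ) / (1 + 7 * θ) - (-2) = (12 * θ) / (1 + 7 * θ) by
      rw [div_sub' h7ne]; congr 1; ring, abs_div, abs_mul, abs_of_pos h7', div_le_iff₀ h7',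
      show |(12 : ℝ)| = 12 by norm_num]
    nlinarith

/-- Collecting the constants: every term of `prod_bound` is `≤ const·𝓛⁻⁵`.
[cite: Zhang2022LandauSiegel, §15 p.88] -/
theorem collect {ℓ α m₀ C₁ C₂ c θa : ℝ} (hℓ : 1 ≤ ℓ) (hm₀ : 0 < m₀) (hα : α = π / ℓ ^ 9)
    (hθa : θa = |c| * π / ℓ ^ 8) :
    |C₁| / ℓ ^ 24 * (4 / (α ^ 2 * m₀) + |C₂| / ℓ ^ 3) + 4 * α ^ 2 * (4 * Real.exp (9 / 2) * ℓ ^ 2) *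
        (|C₂| / ℓ ^ 3) + (24 * θa + 2 * ((5 * |c| * (π + 521) + 1042) * (α * ℓ ^ 3))) ≤
      (4 * |C₁| / (π ^ 2 * m₀) + |C₁| * |C₂| + 16 * π ^ 2 * Real.exp (9 / 2) * |C₂| + 24 * |c| * π +
        2 * ((5 * |c| * (π + 521) + 1042) * π)) / ℓ ^ 5 := by
  have hℓ0 : 0 < ℓ := by linarith
  have hα2 : α ^ 2 = π ^ 2 / ℓ ^ 18 := by rw [hα]; ring
  have t1 : |C₁| / ℓ ^ 24 * (4 / (α ^ 2 * m₀)) = 4 * |C₁| / (π ^ 2 * m₀) * (1 / ℓ ^ 6) := by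
    rw [hα2]; field_simp
  have t2 : |C₁| / ℓ ^ 24 * (|C₂| / ℓ ^ 3) = |C₁| * |C₂| * (1 / ℓ ^ 27) := by field_simp
  have t3 : 4 * α ^ 2 * (4 * Real.exp (9 / 2) * ℓ ^ 2) * (|C₂| / ℓ ^ 3) =
      16 * π ^ 2 * Real.exp (9 / 2) * |C₂| * (1 / ℓ ^ 19) := by
    rw [hα2]; field_simp; ring
  have t4 : 24 * θa = 24 * |c| * π * (1 / ℓ ^ 8) := by rw [hθa]; ring
  have t5 : α * ℓ ^ 3 = π * (1 / ℓ ^ 6) := by rw [hα]; field_simp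
  have i6 := inv_pow_le_inv_pow5 hℓ (show 5 ≤ 6 by norm_num)
  have i8 := inv_pow_le_inv_pow5 hℓ (show 5 ≤ 8 by norm_num)
  have i19 := inv_pow_le_inv_pow5 hℓ (show 5 ≤ 19 by norm_num)
  have i27 := inv_pow_le_inv_pow5 hℓ (show 5 ≤ 27 by norm_num)
  have j6 := mul_le_mul_of_nonneg_left i6 (by positivity : (0:ℝ) ≤ 4 * |C₁| / (π ^ 2 * m₀))
  have j27 := mul_le_mul_of_nonneg_left i27 (by positivity : (0:ℝ) ≤ |C₁| * |C₂|)
  have j19 := mul_le_mul_of_nonneg_left i19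
    (by positivity : (0:ℝ) ≤ 16 * π ^ 2 * Real.exp (9 / 2) * |C₂|)
  have j8 := mul_le_mul_of_nonneg_left i8 (by positivity : (0:ℝ) ≤ 24 * |c| * π)
  have jW := mul_le_mul_of_nonneg_left i6
    (by positivity : (0:ℝ) ≤ 2 * ((5 * |c| * (π + 521) + 1042) * π))
  have eW : 2 * ((5 * |c| * (π + 521) + 1042) * (π * (1 / ℓ ^ 6))) =
      2 * ((5 * |c| * (π + 521) + 1042) * π) * (1 / ℓ ^ 6) := by ring
  rw [mul_add, t1, t2, t3, t4, t5, eW, div_eq_mul_one_div _ (ℓ ^ 5)]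
  nlinarith

end Literature.NumberTheory.LFunctions.Zhang2022.Ded1524
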